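import Mathlib
import Summits.RiemannHypothesis.RiemannHypothesis.Theses.SpectralTrace
import Summits.RiemannHypothesis.RiemannHypothesis.Theorems.WindowTraceArch.Negative.ComplexSpectrum
import Summits.RiemannHypothesis.RiemannHypothesis.Theorems.WindowTraceArch.Negative.LocalWeylTools
import Summits.RiemannHypothesis.RiemannHypothesis.Theorems.WindowTraceArch.Negative.UnitMass
import Literature.NumberTheory.LFunctions.WeilExplicitProofs
import Literature.NumberTheory.LFunctions.WeilMellinBounds
import Literature.NumberTheory.LFunctions.WeilExplicitRightEdge
import Literature.NumberTheory.LFunctions.WeilArchimedeanPositivityProofs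
import Literature.NumberTheory.LFunctions.WeilCriterionProofs

/-!
# Sketch — crux `SpectralIsHpSpectrum` (stmt-RiemannHypothesis-0195), crux-ideate round 1,
ideator 2 (gen 2)

First-lemma signatures for two idea cards:

* **D `self-majorant-peak`** — `#fibre(x) · p̂(1/2) · ĝ(1/2+ix) = lim_n L(g ⋆ p_{n,x})`, the
  Tannery majorant being `i ↦ ‖p‖₁ · ‖ĝ(1/2+iγ_i)‖`, summable BY THE HYPOTHESIS ITSELF
  (`HasSum` in `ℂ` ⇒ norm-summable, `summable_norm_iff`). PROVED here: the lever
  `summable_norm_of_isRealSpectrumFor`, the finiteness of charged fibres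
  `finite_fibre_of_weilMellin_ne_zero`, closure of the test class under the peak construction,
  the dilation substitution `weilMellin_dilate`, the peak limit, the FIRST LEMMA
  `tendsto_trace_conv_peak` (Tannery) and the W-free transfer
  `realSpectrumUnique_via_selfMajorant : RealSpectrumUnique` — the Card D section has NO sorry.
  `SelfMajorantComplete.lean` (same folder / crux dir) adds the vendored reduction and proves the
  crux BY NAME (`spectralIsHpSpectrum_via_selfMajorant`), rc 0, 0 sorry, standard axioms.
* **E `delsarte-minorant`** — lever RECORDED but NOT FILED as a card (moot for this crux once D is
  complete; kept for the route as a finite-level LOWER certificate on local counts of window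
  families): the signed one-sided certificate `q_h := k + k''`, `k = h ⋆ h̃`, whose line
  transform is `(1 - u²)|ĥ(1/2+iu)|² ≤ |ĥ(1/2)|² · 1_{|u| ≤ 1}`; PROVED here: the test property of
  `q_h`, its line transform, the pointwise certificate inequality. Sorried (4): the trace
  inequality, the zero-side limit, the two halves of the count.

The shared reduction `RealSpectrumUnique → SpectralIsHpSpectrum` is kernel-checked in the
published `Cruxes/SpectralIsHpSpectrum/SketchIdeator1.lean`
(`spectralIsHpSpectrum_of_realSpectrumUnique`, same `RealSpectrumUnique` verbatim) on top of the
standing disprover's §1–§2 (`Disproof.lean`); it is re-used (vendored, credited) only in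
`SelfMajorantComplete.lean`, not here.
-/

noncomputable section

open Complex Set MeasureTheory Filter
open scoped Real Topology

namespace Summit.RiemannHypothesis.RiemannHypothesis.Cruxes.SpectralIsHpSpectrum.SketchIdeator2g2

open Literature.NumberTheory.LFunctions
open Summit.RiemannHypothesis.RiemannHypothesis.Theorems.WindowTraceArch.Negative

/-! ## Shared vocabulary (verbatim as in SketchIdeator1.lean) -/

/-- `γ` is a real spectrum for the functional `L`. The crux hypothesis is
`IsRealSpectrumFor γ weilFunctional` (definitionally the disprover's `IsTrace γ`). -/
def IsRealSpectrumFor {ι : Type*} (γ : ι → ℝ) (L : (ℝ → ℂ) → ℂ) : Prop :=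
  ∀ g : ℝ → ℂ, IsWeilTest g → HasSum (fun i => weilMellin g (1 / 2 + (γ i : ℂ) * I)) (L g)

/-- TRANSFER C⁺ (W-free): two real spectra of the SAME functional have equal multiplicities. -/
def RealSpectrumUnique : Prop :=
  ∀ (ι ι' : Type) (γ : ι → ℝ) (γ' : ι' → ℝ) (L : (ℝ → ℂ) → ℂ),
    IsRealSpectrumFor γ L → IsRealSpectrumFor γ' L →
      ∀ x : ℝ, {i | γ i = x}.encard = {j | γ' j = x}.encard

/-- The crux hypothesis, verbatim, is `IsRealSpectrumFor γ weilFunctional`. -/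
example {ι : Type} (γ : ι → ℝ) :
    IsRealSpectrumFor γ weilFunctional ↔
      (∀ g : ℝ → ℂ, IsWeilTest g →
        HasSum (fun i => weilMellin g (1 / 2 + (γ i : ℂ) * I)) (weilFunctional g)) :=
  Iff.rfl

/-! ## Card D — the trace is its own Tannery majorant -/

/-- **THE LEVER.** A real spectrum is absolutely summable against every Weil test: the
hypothesis instance at `g` is its own majorant (`HasSum` in the finite-dimensional space `ℂ`
is unconditional, hence absolute, convergence — `summable_norm_iff`). No local Weyl law, no
positivity, no value of `L` is used. -/
theorem summable_norm_of_isRealSpectrumFor {ι : Type*} {γ : ι → ℝ} {L : (ℝ → ℂ) → ℂ}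
    (hγ : IsRealSpectrumFor γ L) {g : ℝ → ℂ} (hg : IsWeilTest g) :
    Summable fun i => ‖weilMellin g (1 / 2 + (γ i : ℂ) * I)‖ :=
  summable_norm_iff.mpr (hγ g hg).summable

/-- **Charged fibres are finite**: if `ĝ(1/2 + ix) ≠ 0` for some Weil test `g`, the fibre over
`x` is finite (the terms on the fibre are all equal to `ĝ(1/2+ix) ≠ 0`, and a summable family
tends to `0` along the cofinite filter). Since `exists_isWeilTest_re_weilMellin_pos x` supplies
such a `g` for every `x`, EVERY fibre of a real spectrum is finite — without the local Weyl law. -/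
theorem finite_fibre_of_weilMellin_ne_zero {ι : Type*} {γ : ι → ℝ} {L : (ℝ → ℂ) → ℂ}
    (hγ : IsRealSpectrumFor γ L) {g : ℝ → ℂ} (hg : IsWeilTest g) {x : ℝ}
    (hx : weilMellin g (1 / 2 + x * I) ≠ 0) : {i | γ i = x}.Finite := by
  have h0 := (summable_norm_of_isRealSpectrumFor hγ hg).tendsto_cofinite_zero
  have hε : (0 : ℝ) < ‖weilMellin g (1 / 2 + x * I)‖ := norm_pos_iff.mpr hx
  have hev : ∀ᶠ i in cofinite, ‖weilMellin g (1 / 2 + (γ i : ℂ) * I)‖ <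
      ‖weilMellin g (1 / 2 + x * I)‖ := h0.eventually (gt_mem_nhds hε)
  rw [Filter.eventually_cofinite] at hev
  refine hev.subset fun i hi => ?_
  simp only [Set.mem_setOf_eq] at hi ⊢
  rw [hi]
  exact lt_irrefl _

/-- Every fibre of a real spectrum is finite. -/
theorem finite_fibre {ι : Type*} {γ : ι → ℝ} {L : (ℝ → ℂ) → ℂ}
    (hγ : IsRealSpectrumFor γ L) (x : ℝ) : {i | γ i = x}.Finite := by
  obtain ⟨g, hg, hpos⟩ := exists_isWeilTest_re_weilMellin_pos x
  refine finite_fibre_of_weilMellin_ne_zero hγ hg (x := x) fun h0 => ?_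
  have h1 := hpos (1 / 2)
  have h2 : ((1 / 2 : ℝ) : ℂ) + x * I = 1 / 2 + x * I := by push_cast; ring
  rw [h2, h0] at h1
  simp at h1

/-- Dilation `(D_R p)(t) = R⁻¹ p(t / R)`. -/
def dilate (p : ℝ → ℂ) (R : ℝ) : ℝ → ℂ :=
  fun t => ((R : ℝ) : ℂ)⁻¹ * p (t / R)

/-- The peak test `p_{n,x}(t) = e^{-ixt} (n+1)⁻¹ p(t/(n+1))` (modulated dilation; support
`(n+1) · supp p` — this is where "ALL Weil tests" is consumed). -/
def peakTest (p : ℝ → ℂ) (n : ℕ) (x : ℝ) : ℝ → ℂ :=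
  fun t => cexp (-((x * t : ℝ) : ℂ) * I) * dilate p ((n : ℝ) + 1) t

/-- Dilations of Weil tests are Weil tests. -/
theorem isWeilTest_dilate {p : ℝ → ℂ} (hp : IsWeilTest p) {R : ℝ} (hR : 0 < R) :
    IsWeilTest (dilate p R) := by
  refine ⟨contDiff_const.mul (hp.1.comp (contDiff_id.div_const R)), ?_⟩
  have e : (fun t : ℝ => p (t / R)) = p ∘ (Homeomorph.mulRight₀ R⁻¹ (inv_ne_zero hR.ne')) := by
    ext t
    simp [div_eq_mul_inv]
  have h2 : HasCompactSupport fun t : ℝ => p (t / R) := by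
    rw [e]
    exact hp.2.comp_homeomorph _
  exact h2.mul_left

/-- **Dilation substitution**: `(D_R p)^(s) = p̂(1/2 + R (s − 1/2))`, i.e. on the line
`(D_R p)^(1/2 + iu) = p̂(1/2 + iRu)` (`t = R y`; `MeasureTheory.Measure.integral_comp_div`). -/
theorem weilMellin_dilate (p : ℝ → ℂ) {R : ℝ} (hR : 0 < R) (s : ℂ) :
    weilMellin (dilate p R) s = weilMellin p (1 / 2 + R * (s - 1 / 2)) := by
  unfold weilMellin dilate
  set G : ℝ → ℂ := fun y => ((R : ℝ) : ℂ)⁻¹ * p y * cexp ((s - 1 / 2) * (R : ℂ) * (y : ℂ))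
    with hG
  have hRC : ((R : ℝ) : ℂ) ≠ 0 := Complex.ofReal_ne_zero.mpr hR.ne'
  have h1 : (fun t : ℝ => ((R : ℝ) : ℂ)⁻¹ * p (t / R) * cexp ((s - 1 / 2) * (t : ℂ))) =
      fun t : ℝ => G (t / R) := by
    ext t
    simp only [hG]
    congr 2
    push_cast
    field_simp
  have h2 : (fun t : ℝ => p t * cexp ((1 / 2 + (R : ℂ) * (s - 1 / 2) - 1 / 2) * (t : ℂ))) =
      fun t : ℝ => ((R : ℝ) : ℂ) * G t := by
    ext t
    simp only [hG]
    have e : (1 / 2 + (R : ℂ) * (s - 1 / 2) - 1 / 2) * (t : ℂ) = (s - 1 / 2) * (R : ℂ) * (t : ℂ) := by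
      ring
    rw [e]
    field_simp
  rw [h1, h2, MeasureTheory.Measure.integral_comp_div G R, abs_of_pos hR, integral_const_mul,
    Complex.real_smul]

/-- Peak tests are Weil tests (`isWeilTest_modulate` ∘ `isWeilTest_dilate`). -/
theorem isWeilTest_peakTest {p : ℝ → ℂ} (hp : IsWeilTest p) (n : ℕ) (x : ℝ) :
    IsWeilTest (peakTest p n x) :=
  isWeilTest_modulate (isWeilTest_dilate hp (by positivity)) x

/-- Spectral side of the peak test: `p̂(1/2 + i (n+1)(u − x))`
(`weilMellin_modulate` + `weilMellin_dilate`). -/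
theorem weilMellin_peakTest (p : ℝ → ℂ) (n : ℕ) (x u : ℝ) :
    weilMellin (peakTest p n x) (1 / 2 + u * I) =
      weilMellin p (1 / 2 + ((((n : ℝ) + 1) * (u - x) : ℝ) : ℂ) * I) := by
  have h1 : weilMellin (peakTest p n x) (1 / 2 + u * I) =
      weilMellin (dilate p ((n : ℝ) + 1)) (1 / 2 + ((u - x : ℝ) : ℂ) * I) :=
    weilMellin_modulate (dilate p ((n : ℝ) + 1)) x u
  rw [h1, weilMellin_dilate p (by positivity)]
  congr 1
  push_cast
  ring

/-- Uniform bound on the line: `|p_{n,x}^(1/2+iu)| ≤ ‖p‖_{L¹(e^{|t|/2})}` (the Tannery envelope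
is a CONSTANT — no monotone-decay bookkeeping). -/
theorem norm_weilMellin_peakTest_le {p : ℝ → ℂ} (hp : IsWeilTest p) (n : ℕ) (x u : ℝ) :
    ‖weilMellin (peakTest p n x) (1 / 2 + u * I)‖ ≤ weilL1 p := by
  rw [weilMellin_peakTest]
  exact norm_weilMellin_le_weilL1 hp.1.continuous hp.2 (by simp) (by norm_num)

/-- Pointwise limit of the peak values: `p̂(1/2)` on the fibre, `0` off it
(`norm_weilMellin_le`: `|p̂(1/2+iv)| ≤ C_p/(1+v²)` with `v = (n+1)(u−x) → ∞`). -/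
theorem tendsto_weilMellin_peakTest {p : ℝ → ℂ} (hp : IsWeilTest p) (x u : ℝ) :
    Tendsto (fun n : ℕ => weilMellin (peakTest p n x) (1 / 2 + u * I)) atTop
      (𝓝 (if u = x then weilMellin p (1 / 2) else 0)) := by
  simp_rw [weilMellin_peakTest]
  by_cases hu : u = x
  · subst hu
    simp only [sub_self, mul_zero, Complex.ofReal_zero, zero_mul, add_zero, if_true]
    exact tendsto_const_nhds
  · rw [if_neg hu]
    have hux : 0 < (u - x) ^ 2 := by
      have : u - x ≠ 0 := sub_ne_zero.mpr hu
      positivity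
    have him : ∀ v : ℝ, ((1 / 2 : ℂ) + (v : ℂ) * I).im = v := fun v => by simp
    have hbound : ∀ n : ℕ, ‖weilMellin p (1 / 2 + ((((n : ℝ) + 1) * (u - x) : ℝ) : ℂ) * I)‖ ≤
        weilDecayConst p / (1 + (((n : ℝ) + 1) * (u - x)) ^ 2) := by
      intro n
      have h := norm_weilMellin_le hp (s := 1 / 2 + ((((n : ℝ) + 1) * (u - x) : ℝ) : ℂ) * I)
        (by simp) (by norm_num)
      rwa [him] at h
    have hden : Tendsto (fun n : ℕ => 1 + (((n : ℝ) + 1) * (u - x)) ^ 2) atTop atTop := by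
      have h1 : Tendsto (fun n : ℕ => ((n : ℝ) + 1)) atTop atTop :=
        tendsto_atTop_add_const_right _ 1 tendsto_natCast_atTop_atTop
      have h2 : Tendsto (fun n : ℕ => ((n : ℝ) + 1) ^ 2) atTop atTop :=
        (tendsto_pow_atTop two_ne_zero).comp h1
      have h3 : Tendsto (fun n : ℕ => (u - x) ^ 2 * ((n : ℝ) + 1) ^ 2) atTop atTop :=
        h2.const_mul_atTop hux
      have h4 : Tendsto (fun n : ℕ => 1 + (u - x) ^ 2 * ((n : ℝ) + 1) ^ 2) atTop atTop :=
        tendsto_atTop_add_const_left _ 1 h3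
      refine h4.congr fun n => ?_
      ring
    have hlim : Tendsto (fun n : ℕ => weilDecayConst p / (1 + (((n : ℝ) + 1) * (u - x)) ^ 2))
        atTop (𝓝 0) := tendsto_const_nhds.div_atTop hden
    exact squeeze_zero_norm hbound hlim

/-- **FIRST LEMMA of card D (self-majorised Tannery limit).** For a real spectrum `γ` of ANY
functional `L` on Weil tests, any Weil tests `g, p` and any `x ∈ ℝ`:
`L(g ⋆ p_{n,x}) ⟶ #{i | γ_i = x} · p̂(1/2) · ĝ(1/2 + ix)` as `n → ∞`.
Proof: `L(g ⋆ p_{n,x}) = Σ_i ĝ(γ_i) · p̂(1/2 + i(n+1)(γ_i − x))` (hypothesis at the Weil test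
`g ⋆ p_{n,x}`, `weilMellin_weilConv_holds`); Tannery (`tendsto_tsum_of_dominated_convergence`)
with the bound `i ↦ weilL1 p · ‖ĝ(γ_i)‖`, summable by `summable_norm_of_isRealSpectrumFor`;
the limit family is supported on the (finite, `finite_fibre`) fibre where it is constant.
The statement is true even read with `ncard`'s junk value: an infinite fibre forces
`ĝ(1/2+ix) = 0` (`finite_fibre_of_weilMellin_ne_zero`). -/
theorem tendsto_trace_conv_peak {ι : Type*} {γ : ι → ℝ} {L : (ℝ → ℂ) → ℂ}
    (hγ : IsRealSpectrumFor γ L) {g p : ℝ → ℂ} (hg : IsWeilTest g) (hp : IsWeilTest p)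
    (x : ℝ) :
    Tendsto (fun n : ℕ => L (weilConv g (peakTest p n x))) atTop
      (𝓝 ((({i | γ i = x}.ncard : ℕ) : ℂ) *
        (weilMellin p (1 / 2) * weilMellin g (1 / 2 + x * I)))) := by
  have hF : {i | γ i = x}.Finite := finite_fibre hγ x
  set f : ℕ → ι → ℂ := fun n i =>
    weilMellin g (1 / 2 + (γ i : ℂ) * I) * weilMellin (peakTest p n x) (1 / 2 + (γ i : ℂ) * I)
    with hf
  set c : ℂ := weilMellin p (1 / 2) * weilMellin g (1 / 2 + x * I) with hc
  set glim : ι → ℂ := fun i => if γ i = x then c else 0 with hglim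
  -- (1) the majorant is the hypothesis itself
  have hbound : Summable fun i => weilL1 p * ‖weilMellin g (1 / 2 + (γ i : ℂ) * I)‖ :=
    (summable_norm_of_isRealSpectrumFor hγ hg).mul_left _
  have hdom : ∀ᶠ n in atTop, ∀ i, ‖f n i‖ ≤ weilL1 p * ‖weilMellin g (1 / 2 + (γ i : ℂ) * I)‖ :=
    Eventually.of_forall fun n i => by
      simp only [hf, norm_mul]
      rw [mul_comm]
      exact mul_le_mul_of_nonneg_right (norm_weilMellin_peakTest_le hp n x (γ i)) (norm_nonneg _)
  -- (2) pointwise limits: `c` on the fibre, `0` off it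
  have hlim : ∀ i, Tendsto (fun n => f n i) atTop (𝓝 (glim i)) := by
    intro i
    have h := (tendsto_weilMellin_peakTest hp x (γ i)).const_mul
      (weilMellin g (1 / 2 + (γ i : ℂ) * I))
    have e : glim i = weilMellin g (1 / 2 + (γ i : ℂ) * I) *
        (if γ i = x then weilMellin p (1 / 2) else 0) := by
      by_cases hi : γ i = x
      · simp only [hglim, if_pos hi]
        rw [hc, hi]
        ring
      · simp only [hglim, if_neg hi, mul_zero]
    rw [e]
    exact h
  -- (3) Tannery
  have hT := tendsto_tsum_of_dominated_convergence hbound hlim hdom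
  -- (4) the limit family sums to `ncard • c`
  have hzero : ∀ i ∉ hF.toFinset, glim i = 0 := fun i hi => by
    have hi' : ¬ γ i = x := by simpa using hi
    simp only [hglim, if_neg hi']
  have hterm : ∀ i ∈ hF.toFinset, glim i = c := fun i hi => by
    have hi' : γ i = x := by simpa using hi
    simp only [hglim, if_pos hi']
  have hsum : ∑' i, glim i = (({i | γ i = x}.ncard : ℕ) : ℂ) * c := by
    rw [tsum_eq_sum hzero, Finset.sum_congr rfl hterm, Finset.sum_const, nsmul_eq_mul,
      Set.ncard_eq_toFinset_card _ hF]
  -- (5) the trace values are the partial objects of Tannery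
  have hval : ∀ n : ℕ, L (weilConv g (peakTest p n x)) = ∑' i, f n i := fun n => by
    have hq := isWeilTest_peakTest hp n x
    rw [← (hγ _ (hg.weilConv hq)).tsum_eq]
    exact tsum_congr fun i =>
      weilMellin_weilConv_holds hg.1.continuous hg.2 hq.1.continuous hq.2 _
  have hfun : (fun n : ℕ => L (weilConv g (peakTest p n x))) = fun n => ∑' i, f n i := funext hval
  rw [hfun, ← hsum]
  exact hT

/-- **Card D closes the W-free transfer**: both spectra compute the SAME sequence
`n ↦ L(g ⋆ p_{n,x})`; uniqueness of limits in `ℂ` (`tendsto_nhds_unique`) and the choices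
`p` with `p̂(1/2) ≠ 0`, `g` with `ĝ(1/2+ix) ≠ 0` (`exists_isWeilTest_re_weilMellin_pos 0 / x`)
give `ncard = ncard`, and `finite_fibre` turns `ncard` into `encard`. -/
theorem realSpectrumUnique_via_selfMajorant : RealSpectrumUnique := by
  intro ι ι' γ γ' L hγ hγ' x
  obtain ⟨g, hg, hgpos⟩ := exists_isWeilTest_re_weilMellin_pos x
  obtain ⟨p, hp, hppos⟩ := exists_isWeilTest_re_weilMellin_pos 0
  have hgx : weilMellin g (1 / 2 + x * I) ≠ 0 := by
    intro h0
    have h1 := hgpos (1 / 2)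
    have h2 : ((1 / 2 : ℝ) : ℂ) + x * I = 1 / 2 + x * I := by push_cast; ring
    rw [h2, h0] at h1
    simp at h1
  have hp0 : weilMellin p (1 / 2) ≠ 0 := by
    intro h0
    have h1 := hppos (1 / 2)
    have h2 : ((1 / 2 : ℝ) : ℂ) + ((0 : ℝ) : ℂ) * I = 1 / 2 := by push_cast; ring
    rw [h2, h0] at h1
    simp at h1
  have h1 := tendsto_trace_conv_peak hγ hg hp x
  have h2 := tendsto_trace_conv_peak hγ' hg hp x
  have h3 := tendsto_nhds_unique h1 h2
  have hc : weilMellin p (1 / 2) * weilMellin g (1 / 2 + x * I) ≠ 0 := mul_ne_zero hp0 hgx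
  have h4 := mul_right_cancel₀ hc h3
  have h5 : {i | γ i = x}.ncard = {j | γ' j = x}.ncard := by exact_mod_cast h4
  rw [← (finite_fibre hγ x).cast_ncard_eq, ← (finite_fibre hγ' x).cast_ncard_eq, h5]

/-- Engine check: Tannery's theorem in the shape used (bound a CONSTANT multiple of the
hypothesis' own norms). -/
example {ι : Type*} (f : ℕ → ι → ℂ) (g : ι → ℂ) (bound : ι → ℝ) (hb : Summable bound)
    (hlim : ∀ i, Tendsto (fun n => f n i) atTop (𝓝 (g i)))
    (hdom : ∀ᶠ n in atTop, ∀ i, ‖f n i‖ ≤ bound i) :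
    Tendsto (fun n => ∑' i, f n i) atTop (𝓝 (∑' i, g i)) :=
  tendsto_tsum_of_dominated_convergence hb hlim hdom

/-- Engine check: the calibration family is a real spectrum of `W` under RH (landed
`hasSum_weilMellin_zeros` + `eq_half_add_of_riemannHypothesis`), so card D's lemma applies to
it with `L = weilFunctional` exactly as to the unknown family. -/
example (hRH : _root_.RiemannHypothesis) :
    IsRealSpectrumFor (fun p : (Σ ρ : ZetaZeros.riemannZetaNontrivialZeros,
      Fin (riemannZetaZeroOrder (ρ : ℂ)).toNat) => (p.1 : ℂ).im) weilFunctional := by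
  intro g hg
  simpa only [eq_half_add_of_riemannHypothesis hRH] using hasSum_weilMellin_zeros hg

/-! ## Card E — Delsarte minorant: a signed one-sided certificate from `t² ↔ −d²/dt²` -/

/-- The minorant test `q_h := k + k''` with `k = h ⋆ h̃`. -/
def minorantTest (h : ℝ → ℂ) : ℝ → ℂ :=
  weilConv h (weilReflect h) + deriv (deriv (weilConv h (weilReflect h)))

/-- `q_h` is a Weil test (`IsWeilTest.weilConv/.weilReflect/.deriv/.add`). -/
theorem isWeilTest_minorantTest {h : ℝ → ℂ} (hh : IsWeilTest h) : IsWeilTest (minorantTest h) :=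
  (hh.weilConv hh.weilReflect).add (hh.weilConv hh.weilReflect).deriv.deriv

/-- **Line transform of the minorant test**: `q̂_h(1/2+iu) = (1 − u²) |ĥ(1/2+iu)|²`
(`weilMellin_deriv_deriv`: `(k'')^(s) = (s − 1/2)² k̂(s)`, `(iu)² = −u²`;
`weilMellin_weilConv_weilReflect_half`: `k̂(1/2+iu) = |ĥ(1/2+iu)|²`). -/
theorem weilMellin_minorantTest {h : ℝ → ℂ} (hh : IsWeilTest h) (u : ℝ) :
    weilMellin (minorantTest h) (1 / 2 + u * I) =
      (((1 - u ^ 2) * ‖weilMellin h (1 / 2 + u * I)‖ ^ 2 : ℝ) : ℂ) := by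
  have hk : IsWeilTest (weilConv h (weilReflect h)) := hh.weilConv hh.weilReflect
  unfold minorantTest
  rw [weilMellin_add hk.1.continuous hk.2 hk.deriv.deriv.1.continuous hk.deriv.deriv.2,
    weilMellin_deriv_deriv hk, weilMellin_weilConv_weilReflect_half hh]
  have hI : ((1 / 2 : ℂ) + u * I - 1 / 2) ^ 2 = -((u ^ 2 : ℝ) : ℂ) := by
    push_cast
    ring_nf
    rw [Complex.I_sq]
    ring
  rw [hI]
  push_cast
  ring

/-- **Pointwise certificate**: if `|ĥ(1/2+iu)| ≤ |ĥ(1/2)|` for all `u` (true for a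
non-negative real bump: `|∫ h e^{iut}| ≤ ∫ h`), then
`(1 − u²)|ĥ(1/2+iu)|² ≤ |ĥ(1/2)|² · 1_{[−1,1]}(u)`: a SIGNED spectral minorant of the
indicator of `[−1, 1]` realised by a Weil test. -/
theorem minorant_le_indicator {h : ℝ → ℂ}
    (hmax : ∀ u : ℝ, ‖weilMellin h (1 / 2 + u * I)‖ ≤ ‖weilMellin h (1 / 2)‖) (u : ℝ) :
    (1 - u ^ 2) * ‖weilMellin h (1 / 2 + u * I)‖ ^ 2 ≤
      ‖weilMellin h (1 / 2)‖ ^ 2 * (Set.Icc (-1 : ℝ) 1).indicator 1 u := by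
  have h0 : 0 ≤ ‖weilMellin h (1 / 2 + u * I)‖ := norm_nonneg _
  have h1 := hmax u
  by_cases hu : u ∈ Set.Icc (-1 : ℝ) 1
  · rw [Set.indicator_of_mem hu, Pi.one_apply, mul_one]
    have hu2 : 0 ≤ 1 - u ^ 2 := by
      rcases hu with ⟨ha, hb⟩
      nlinarith
    calc (1 - u ^ 2) * ‖weilMellin h (1 / 2 + u * I)‖ ^ 2
        ≤ 1 * ‖weilMellin h (1 / 2 + u * I)‖ ^ 2 := by
          apply mul_le_mul_of_nonneg_right _ (by positivity)
          nlinarith [sq_nonneg u]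
      _ ≤ ‖weilMellin h (1 / 2)‖ ^ 2 := by
          rw [one_mul]
          exact pow_le_pow_left₀ h0 h1 2
  · rw [Set.indicator_of_notMem hu, mul_zero]
    have hu2 : 1 - u ^ 2 ≤ 0 := by
      simp only [Set.mem_Icc, not_and_or, not_le] at hu
      rcases hu with hu | hu <;> nlinarith
    exact mul_nonpos_of_nonpos_of_nonneg hu2 (by positivity)

/-- **FIRST LEMMA of card E (the trace certificate, W-free, pointwise).** For a real spectrum
`γ` of any functional `L`, a test `h` with `|ĥ(1/2+iu)| ≤ |ĥ(1/2)|`, and any finset `S`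
containing every index with `|γ_i − x| ≤ 1/(n+1)`:
`Re L(q_{n,x}) ≤ |ĥ(1/2)|² · #S`, where `q_{n,x} = peakTest (minorantTest h) n x` has line
transform `(1 − v²)|ĥ(1/2+iv)|²` at `v = (n+1)(u − x)` (`weilMellin_peakTest`,
`weilMellin_minorantTest`). Proof: the HasSum is a sum of REAL terms, `≤ |ĥ(1/2)|²` on `S` and
`≤ 0` off `S` (`minorant_le_indicator`); `hasSum_le` against the finitely supported comparison
family. No limit, no summability estimate, no finiteness of fibres is needed on the family side. -/
theorem re_trace_minorant_le_card {ι : Type*} {γ : ι → ℝ} {L : (ℝ → ℂ) → ℂ}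
    (hγ : IsRealSpectrumFor γ L) {h : ℝ → ℂ} (hh : IsWeilTest h)
    (hmax : ∀ u : ℝ, ‖weilMellin h (1 / 2 + u * I)‖ ≤ ‖weilMellin h (1 / 2)‖)
    (x : ℝ) (n : ℕ) (S : Finset ι) (hS : ∀ i, |γ i - x| ≤ 1 / ((n : ℝ) + 1) → i ∈ S) :
    (L (peakTest (minorantTest h) n x)).re ≤ ‖weilMellin h (1 / 2)‖ ^ 2 * S.card := by
  sorry

/-- **Zero-side evaluation (under RH, all summability in tree).** For any Weil test `q`,
`W(q_{n,x}) ⟶ m(1/2+ix) · q̂(1/2)`: Tannery on the calibration family with the majorant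
`m(ρ) · C/(1+(Im ρ − x)²)` uniform in `n ≥ 0` (`norm_weilMellin_le` / `norm_weilMellin_le_sq`,
`summable_norm_zeroSide_of_le`, `weilZeroSummable`). Same shape as card D's lemma with
`L = weilFunctional` and `g` absent; shared with card `fejer-fatou-sandwich` (B3). -/
theorem tendsto_weilFunctional_peakTest (hRH : _root_.RiemannHypothesis) {q : ℝ → ℂ}
    (hq : IsWeilTest q) (x : ℝ) :
    Tendsto (fun n : ℕ => weilFunctional (peakTest q n x)) atTop
      (𝓝 ((riemannZetaZeroOrder (1 / 2 + x * I) : ℂ) * weilMellin q (1 / 2))) := by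
  sorry

/-- **Card E, lower half**: `m(1/2+ix) ≤ #{i | γ_i = x}` for every real spectrum of `W`
(certificate `re_trace_minorant_le_card` on the sets `S_n = {i : |γ_i − x| ≤ 1/(n+1)}`, finite by
`card_mul_norm_sq_le_of_windowTrace` + `exists_bump_lower`, decreasing to the fibre, hence
eventually equal to it; then `tendsto_weilFunctional_peakTest` and `ge_of_tendsto`). -/
theorem order_le_ncard_fibre (hRH : _root_.RiemannHypothesis) {ι : Type} {γ : ι → ℝ}
    (hγ : IsRealSpectrumFor γ weilFunctional) (x : ℝ) :
    riemannZetaZeroOrder (1 / 2 + x * I) ≤ (({i | γ i = x}.ncard : ℕ) : ℤ) := by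
  sorry

/-- **Card E, upper half** (the Fatou majorant; = card `fejer-fatou-sandwich` step 1):
`#{i | γ_i = x} · |ĥ(1/2)|² ≤ W(k_{n,x}) ⟶ m(1/2+ix) |ĥ(1/2)|²` (`sum_le_hasSum` on the fibre,
`tendsto_weilFunctional_peakTest`, `le_of_tendsto'`). -/
theorem ncard_fibre_le_order (hRH : _root_.RiemannHypothesis) {ι : Type} {γ : ι → ℝ}
    (hγ : IsRealSpectrumFor γ weilFunctional) (x : ℝ) :
    (({i | γ i = x}.ncard : ℕ) : ℤ) ≤ riemannZetaZeroOrder (1 / 2 + x * I) := by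
  sorry

/-- Card E reaches the disprover's reduced form of the crux
(`Disproof.spectralIsHpSpectrum_iff_rigidity_under_rh`, right-hand side, verbatim). -/
theorem rigidity_under_rh_via_certificates :
    ∀ (ι : Type) (γ : ι → ℝ), _root_.RiemannHypothesis →
      (∀ g : ℝ → ℂ, IsWeilTest g →
        HasSum (fun i => weilMellin g (1 / 2 + (γ i : ℂ) * I)) (weilFunctional g)) →
      ∀ τ : ℝ, (({i : ι | γ i = τ}.ncard : ℕ) : ℤ) = riemannZetaZeroOrder (1 / 2 + τ * I) :=
  fun _ _ hRH hγ τ => le_antisymm (ncard_fibre_le_order hRH hγ τ) (order_le_ncard_fibre hRH hγ τ)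

end Summit.RiemannHypothesis.RiemannHypothesis.Cruxes.SpectralIsHpSpectrum.SketchIdeator2g2

end
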